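import Literature.NumberTheory.Transcendental.BrownMotivicOrbit
import Literature.NumberTheory.Transcendental.BrownIharaGroupLaw
import HarnessLib

/-!
# Brown's comparison `dch = g τ(√t₀).γ` at points, and the orbit form of the motivic input

`BrownMotivicOrbit.lean` reduces Brown's package `MotivicMZV` to the Deligne–Goncharov input in
coordinates: an Ihara-homomorphic graded shuffle character `ρ : 𝒪(₀Π₁) → 𝒰'` (`ρ_hom`, at the
universal pair of points), an even rational point `γ`, and a real point `(g, t₀)` of `G_𝒰 × 𝔸¹`
with `perLin g t₀ (Ψ ρ γ w) = dch w`.  This file rewrites the last two hypotheses in the language of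
POINTS, which is the language of the sources:

* `perLin_Ψ_eq_iharaLaw` — **Brown's (2.12) evaluated**: for a real character `g` of `𝒰` the
  functional `per = perLin g t₀` composed with `Ψ` is the point `a ⋆ x` of `₀Π₁(ℝ)`, where
  `a = g ∘ ρ = g·₀1₁` is the image of the real point `g` under the orbit map and
  `x = τ(√t₀).γ : w ↦ γ(w) t₀^{|w|/2}` (`γ` even), `⋆` being Ihara's law `iharaLaw` of
  `BrownIharaGroupLaw.lean` ([DG05, (5.12.1)] in Brown's orientation): the coaction (2.3)/(2.5)
  paired with `(g, x)` IS the action `g·x = (g·₀1₁) ∘ x` ([Brown2012, §2.1 (2.3)–(2.6), §2.3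
  (2.12)]; [DG05, Prop. 5.11 (5.11.5), 5.12]);
* `perLin_eq_of_mem_uPrime` — on `𝒰'` the functional `perLin (b ↦ a(f_b)) t₀` is the real point
  `a : 𝒰 → ℝ` itself (no `f₂`);
* `motivicMZV_nonempty_of_orbit` — Brown's package from: `ρ` as before, `γ` even rational, and a
  real point `(a, t₀)` of `G_𝒰 × 𝔸¹` with **`dch = (a ∘ ρ) ⋆ τ(√t₀).γ`** verbatim
  ([Brown2012, §2.3 (2.12)]: "`(g, t) ↦ g τ(√t).γ`" is onto `𝒵 ∋ dch`; [DG05, (5.19.2), 5.20]: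
  `dch ∈ ι(U_ω) ∘ D_σ` with `a_σ⁰` real and `log v_σ` even);
* `ρ_hom_of_pointHom` / `pointHom_of_ρ_hom` — the hypothesis `ρ_hom` (homomorphy of the orbit map
  at the universal pair `(x ↦ x ⊗ 1, y ↦ 1 ⊗ y)`) is EQUIVALENT to homomorphy at all pairs of
  `B`-points of `G_𝒰`, `(g*h)·₀1₁ = (g·₀1₁) ⋆ (h·₀1₁)` ([DG05, (5.10.3), (5.15.1)]: `U_ω → V_ω ≅ Π`
  is a morphism of group schemes), so that the input can be stated entirely at points
  (`motivicMZV_nonempty_of_pointOrbit`).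

No definition and no named fact is introduced (theorems only).

## References

* F. Brown, *Mixed Tate motives over ℤ*, Ann. of Math. 175 (2012), §2; arXiv:1102.1312.
  [Brown2012]
* P. Deligne, A. B. Goncharov, *Groupes fondamentaux motiviques de Tate mixte*, Ann. Sci. ÉNS 38
  (2005), §5; arXiv:math/0302267. [DeligneGoncharov2005]
-/

noncomputable section

namespace Literature.NumberTheory.Transcendental

namespace Brown2012

open MZV ShuffleMonoidAlgebra
open GoncharovFormalIteratedIntegrals (splittings gapProdF conv iharaMul)
open GoncharovFormalIteratedIntegrals renaming phi → phiK, phi_apply → phiK_apply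

/-! ## The period functional at a real point -/

section PerLin

variable (g : List ℕ → ℝ) (t₀ : ℝ)

/-- `perLin` on a symbol: `f₂^m f_b ↦ r t₀^m g(b)`. [cite: Brown2012, (2.11) and §2.3 (2.13)] -/
theorem perLin_single (p : ℕ × List ℕ) (r : ℚ) :
    perLin g t₀ (single p r) = r • (t₀ ^ p.1 * g p.2) :=
  liftLin_single _ p r

/-- `perLin` is unital once `g(∅) = 1`. [folklore] -/
theorem perLin_one (g_nil : g [] = 1) : perLin g t₀ 1 = 1 := by
  rw [one_def, e_def, perLin_single, g_nil, pow_zero, mul_one, one_smul]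

/-- **`perLin g t₀` is multiplicative for a character `g`** (evaluation at the real point
`(g, t₀)` of `G_𝒰 × 𝔸¹` is an algebra homomorphism). [cite: Brown2012, (2.11)] -/
theorem perLin_mul (g_mul : ∀ a b : List ℕ, g a * g b = ((shuffleWord a b).map g).sum)
    (x y : UAlg) : perLin g t₀ (x * y) = perLin g t₀ x * perLin g t₀ y :=
  liftLin_mul _ (by
    rintro ⟨m, a⟩ ⟨m', b⟩
    dsimp only
    rw [mul_mul_mul_comm, ← pow_add, g_mul, ← List.sum_map_mul_left]) x y

/-- `perLin` evaluates the twist `χ γ v = γ(v) f₂^{|v|/2}` to `γ(v) t₀^{|v|/2}`: the coordinate `v`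
of the point `τ(√t₀).γ` ("`τ(λ)` multiplies elements of degree `d` by `λ^d`", `γ` even).
[cite: Brown2012, §2.3 (2.12)] -/
theorem perLin_χ (g_nil : g [] = 1) (γ : List Bool → ℚ) (v : List Bool) :
    perLin g t₀ (χ γ v) = (γ v : ℝ) * t₀ ^ (v.length / 2) := by
  rw [χ, perLin_single, g_nil, mul_one, Rat.smul_def]

/-- `perLin` commutes with the reduction `Iᵐ` of general endpoints to `(0, ·, 1)` (I0, I1, I3 are
linear rules). [cite: Brown2012, §2.4 I0, I1, I3] -/
theorem perLin_Im (J : List Bool → UAlg) (x : Bool) (u : List Bool) (y : Bool) :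
    perLin g t₀ (Im J x u y) = Im (fun v => perLin g t₀ (J v)) x u y := by
  simp only [Im]
  split_ifs <;> simp only [map_zero, map_smul]

/-- **`perLin` of a Galois factor is the Galois factor of the real point `a = g ∘ ρ`**:
`per (Iᵐ_ρ(x; g₀; k₁) ⋯ Iᵐ_ρ(k_r; g_r; y)) = Iᵐ_a(x; g₀; k₁) ⋯ Iᵐ_a(k_r; g_r; y)`.
[cite: Brown2012, Theorem 2.4 (2.18) and (2.11)] -/
theorem perLin_galoisFactor (g_mul : ∀ a b : List ℕ, g a * g b = ((shuffleWord a b).map g).sum)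
    (J : List Bool → UAlg) :
    ∀ (x : Bool) (g₀ : List Bool) (ps : List (Bool × List Bool)) (y : Bool),
      perLin g t₀ (galoisFactor J x g₀ ps y) =
        gapProdF (Im fun v => perLin g t₀ (J v)) x g₀ ps y
  | x, g₀, [], y => perLin_Im g t₀ J x g₀ y
  | x, g₀, p :: ps, y => by
    rw [galoisFactor, gapProdF, perLin_mul g t₀ g_mul, perLin_Im, perLin_galoisFactor g_mul J]

/-- **Brown's (2.12) evaluated: `per ∘ Ψ` is the point `(g·₀1₁) ⋆ τ(√t₀).γ`.**  For a shuffle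
character `ρ` and a real character `g`, the period functional of `Ψ ρ γ w = (id ⊗ ev_{τ(√t₀)γ})
(coaction w)` is the `w`-coordinate of `a ⋆ x`, `a = g ∘ ρ` the image of the real point `g` of
`G_𝒰` under the orbit map and `x = τ(√t₀).γ`; i.e. pairing the coaction (2.3) with `(g, x)` is the
action `g·x = (g·₀1₁) ∘ x` of [DG05, 5.11–5.12] (Ihara's law, Brown's orientation).
[cite: Brown2012, §2.1 (2.3)–(2.6), §2.3 (2.12), Theorem 2.4; DeligneGoncharov2005, (5.11.5),
(5.12.1)] -/
theorem perLin_Ψ_eq_iharaLaw (ρ : List Bool → UAlg) (ρ_nil : ρ [] = 1)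
    (ρ_mul : ∀ u v : List Bool, ρ u * ρ v = ((shuffleWord u v).map ρ).sum)
    (g_nil : g [] = 1) (g_mul : ∀ a b : List ℕ, g a * g b = ((shuffleWord a b).map g).sum)
    (γ : List Bool → ℚ) (w : List Bool) :
    perLin g t₀ (Ψ ρ γ w) =
      iharaLaw (fun v => perLin g t₀ (ρ v)) (fun v => (γ v : ℝ) * t₀ ^ (v.length / 2)) w := by
  set a : GoncharovFormalIteratedIntegrals.WordSeries Bool ℝ := fun v => perLin g t₀ (ρ v) with ha
  have ha1 : a [] = 1 := by rw [ha]; dsimp only; rw [ρ_nil, perLin_one g t₀ g_nil]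
  have hamul : ∀ u v : List Bool, a u * a v = ((shuffleWord u v).map a).sum := fun u v => by
    rw [ha]; dsimp only
    rw [← perLin_mul g t₀ g_mul, ρ_mul, map_list_sum, List.map_map]
    rfl
  rw [iharaLaw_apply a ha1 hamul, conv, Ψ, map_list_sum, List.map_map]
  refine congrArg List.sum (List.map_congr_left fun sp _ => ?_)
  rw [Function.comp_apply, perLin_mul g t₀ g_mul, perLin_galoisFactor g t₀ g_mul, perLin_χ g t₀ g_nil,
    mul_comm]
  rfl

end PerLin

/-! ## A real point of `G_𝒰` as a character table -/

section RealPoint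

variable (a : UAlg →+* ℝ)

/-- The character table `b ↦ a(f_b)` of a real point is unital. [folklore] -/
theorem table_nil : a (e 0 []) = 1 := by rw [e_zero_nil, map_one]

/-- The character table `b ↦ a(f_b)` of a real point is a shuffle character. [folklore] -/
theorem table_mul (u v : List ℕ) :
    a (e 0 u) * a (e 0 v) = ((shuffleWord u v).map fun b => a (e 0 b)).sum := by
  rw [← map_mul, e_mul_e, map_list_sum, List.map_map]
  rfl

/-- **On `𝒰'` the functional `perLin (b ↦ a(f_b)) t₀` is the point `a` itself** (elements of `𝒰'`
have no `f₂`). [cite: Brown2012, (2.20)–(2.21)] -/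
theorem perLin_eq_of_mem_uPrime (t₀ : ℝ) {N : ℕ} {x : UAlg} (hx : x ∈ uPrime N) :
    perLin (fun b => a (e 0 b)) t₀ x = a x := by
  classical
  rw [mem_uPrime] at hx
  conv_lhs => rw [← sum_single x]
  conv_rhs => rw [← sum_single x]
  rw [map_sum, map_sum]
  refine Finset.sum_congr rfl fun p hp => ?_
  have hp0 : p.1 = 0 := (hx p (Finsupp.mem_support_iff.1 hp)).2
  obtain ⟨m, b⟩ := p
  simp only at hp0
  subst hp0
  rw [perLin_single, pow_zero, one_mul, ← smul_e, map_rat_smul]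

end RealPoint

/-! ## The package from the orbit form `dch = (a ∘ ρ) ⋆ τ(√t₀).γ` -/

/-- **Brown's package from the orbit form of the comparison.**  Input: an Ihara-homomorphic
graded shuffle character `ρ : 𝒪(₀Π₁) → 𝒰'` (`ρ_hom` at the universal pair of points, see
`ρ_hom_of_pointHom`), an even rational point `γ` of `₀Π₁`, and a real point `(a, t₀)` of
`G_𝒰 × 𝔸¹` with `dch = (a ∘ ρ) ⋆ τ(√t₀).γ` — [Brown2012, §2.3 (2.12)] "`(g, t) ↦ g τ(√t).γ`,
`G'_𝒰 × 𝔸¹ ≅ 𝒵 ∋ dch`", [DG05, (5.19.2), 5.20] "`dch(σ) ∈ ι(U_ω) ∘ D_σ`".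
[cite: Brown2012, §2.1 (2.3)–(2.6), §2.3 (2.12); DeligneGoncharov2005, (5.12.1), (5.19.2), 5.20] -/
theorem motivicMZV_nonempty_of_orbit (ρ : List Bool → UAlg) (ρ_nil : ρ [] = 1)
    (ρ_mul : ∀ u v : List Bool, ρ u * ρ v = ((shuffleWord u v).map ρ).sum)
    (ρ_mem : ∀ w : List Bool, ρ w ∈ uPrime w.length)
    (ρ_hom : ∀ w : List Bool, decHom (ρ w) = iharaMul (orbitFamilyL ρ) (orbitR ρ) w)
    (γ : List Bool → ℚ) (γ_nil : γ [] = 1)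
    (γ_mul : ∀ u v : List Bool, γ u * γ v = ((shuffleWord u v).map γ).sum)
    (γ_odd : ∀ w : List Bool, Odd w.length → γ w = 0) (a : UAlg →+* ℝ) (t₀ : ℝ)
    (orbit : ∀ w : List Bool,
      dch w = iharaLaw (fun v => a (ρ v)) (fun v => (γ v : ℝ) * t₀ ^ (v.length / 2)) w) :
    motivicMZV_nonempty := by
  refine motivicMZV_nonempty_of_iharaComparison ρ ρ_nil ρ_mul ρ_mem ρ_hom γ γ_nil γ_mul γ_odd
    (fun b => a (e 0 b)) (table_nil a) (table_mul a) t₀ fun w => ?_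
  rw [perLin_Ψ_eq_iharaLaw _ t₀ ρ ρ_nil ρ_mul (table_nil a) (table_mul a), orbit w]
  congr 1
  funext v
  exact perLin_eq_of_mem_uPrime a t₀ (ρ_mem v)

/-! ## `ρ_hom` is homomorphy of the orbit map at all points -/

/-- A ring homomorphism out of `𝒰` commutes with the reduction `Iᵐ` (I0, I1, I3 are `ℚ`-linear
rules, and additive maps of `ℚ`-modules are `ℚ`-linear). [cite: Brown2012, §2.4 I0, I1, I3] -/
theorem map_Im {B : Type} [CommRing B] [Algebra ℚ B] (f : UAlg →+* B) (J : List Bool → UAlg)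
    (x : Bool) (u : List Bool) (y : Bool) : f (Im J x u y) = Im (fun v => f (J v)) x u y := by
  simp only [Im]
  split_ifs <;> simp only [map_zero, map_rat_smul]

/-- **Homomorphy at all points implies `ρ_hom`** (the universal pair `(x ↦ x ⊗ 1, y ↦ 1 ⊗ y)` of
points of `G_𝒰` with values in `𝒰 ⊗ 𝒰` has product `decHom`, `pointMul_leftEmb_algebraMap`).
[cite: DeligneGoncharov2005, (5.10.3), (5.12.1), (5.15.1); Brown2012, (2.20)] -/
theorem ρ_hom_of_pointHom (ρ : List Bool → UAlg)
    (h : ∀ (B : Type) [CommRing B] [Algebra ℚ B] (g h : UAlg →+* B) (w : List Bool),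
      pointMul g h (ρ w) = iharaLaw (fun v => g (ρ v)) (fun v => h (ρ v)) w)
    (w : List Bool) : decHom (ρ w) = iharaMul (orbitFamilyL ρ) (orbitR ρ) w := by
  letI := ratAlgebraUU
  rw [← pointMul_leftEmb_algebraMap, h UU leftEmb (algebraMap UAlg UU) w, iharaLaw]
  congr 1
  funext x u y
  rw [orbitFamilyL, map_Im]

/-- **`ρ_hom` implies homomorphy at all points**: `(g*h)·₀1₁ = (g·₀1₁) ⋆ (h·₀1₁)` for all
`B`-points `g, h` of `G_𝒰` (`pointMul_ρ_eq_iharaMul` in the notation `iharaLaw`).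
[cite: DeligneGoncharov2005, (5.10.3), (5.12.1), (5.15.1); Brown2012, (2.20)] -/
theorem pointHom_of_ρ_hom (ρ : List Bool → UAlg)
    (ρ_hom : ∀ w : List Bool, decHom (ρ w) = iharaMul (orbitFamilyL ρ) (orbitR ρ) w)
    {B : Type} [CommRing B] [Algebra ℚ B] (g h : UAlg →+* B) (w : List Bool) :
    pointMul g h (ρ w) = iharaLaw (fun v => g (ρ v)) (fun v => h (ρ v)) w := by
  rw [pointMul_ρ_eq_iharaMul g h ρ ρ_hom, iharaLaw]
  congr 1
  funext x u y
  exact map_Im g ρ x u y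

/-- **Brown's package from the input stated entirely at points**: a graded shuffle character
`ρ : 𝒪(₀Π₁) → 𝒰'` whose orbit map `g ↦ g·₀1₁ = g ∘ ρ` is a homomorphism `G_𝒰(B) → (₀Π₁(B), ⋆)`
for every commutative `ℚ`-algebra `B` ([DG05, (5.10.3), Prop. 5.11, 5.12, (5.15.1)] with
`𝒪(U_ω) ≅ 𝒰'`, [DG05, Prop. 2.2–2.3], [Brown2012, (2.20)]), an even rational point `γ`, and a real
point `(a, t₀)` of `G_𝒰 × 𝔸¹` with `dch = (a ∘ ρ) ⋆ τ(√t₀).γ` ([Brown2012, §2.3 (2.12)];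
[DG05, 5.16, (5.19.2), 5.20]).
[cite: Brown2012, §2.1 (2.3)–(2.6), §2.3 (2.12), (2.20); DeligneGoncharov2005, (5.10.3),
Prop. 5.11, (5.12.1), (5.15.1), 5.16, (5.19.2), 5.20] -/
theorem motivicMZV_nonempty_of_pointOrbit (ρ : List Bool → UAlg) (ρ_nil : ρ [] = 1)
    (ρ_mul : ∀ u v : List Bool, ρ u * ρ v = ((shuffleWord u v).map ρ).sum)
    (ρ_mem : ∀ w : List Bool, ρ w ∈ uPrime w.length)
    (ρ_pt : ∀ (B : Type) [CommRing B] [Algebra ℚ B] (g h : UAlg →+* B) (w : List Bool),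
      pointMul g h (ρ w) = iharaLaw (fun v => g (ρ v)) (fun v => h (ρ v)) w)
    (γ : List Bool → ℚ) (γ_nil : γ [] = 1)
    (γ_mul : ∀ u v : List Bool, γ u * γ v = ((shuffleWord u v).map γ).sum)
    (γ_odd : ∀ w : List Bool, Odd w.length → γ w = 0) (a : UAlg →+* ℝ) (t₀ : ℝ)
    (orbit : ∀ w : List Bool,
      dch w = iharaLaw (fun v => a (ρ v)) (fun v => (γ v : ℝ) * t₀ ^ (v.length / 2)) w) :
    motivicMZV_nonempty :=
  motivicMZV_nonempty_of_orbit ρ ρ_nil ρ_mul ρ_mem (ρ_hom_of_pointHom ρ ρ_pt) γ γ_nil γ_mul γ_odd a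
    t₀ orbit

end Brown2012

end Literature.NumberTheory.Transcendental
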